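import Summits.FinalStateConjecture.FinalStateConjecture.Theses.BartnikGapSettling
import Summits.FinalStateConjecture.FinalStateConjecture.Theorems.TameCensorshipCollarMargin.Negative.TameCensorshipCollarMarginFalseOfExtremalJunkCollars
import Summits.FinalStateConjecture.FinalStateConjecture.Theorems.WeakCosmicCensorshipMGHD.Negative.LoadBearing
import Literature.Geometry.Lorentzian.CompleteDevelopmentMaximal
import Literature.Geometry.Lorentzian.FlatQuietCollarExclusion
import Literature.Geometry.Lorentzian.KerrCurvatureInvariants
import Literature.Geometry.Lorentzian.TrivialDataAdmissible

/-!
# Line `zdm-spinup-window` is DEAD for the filed crux — kernel certificate with minimal hypotheses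
# (crux `TameCensorshipCollarMargin`, stmt-FinalStateConjecture-17329; lead a1, 2026-08-17)

Companion of `Lines/zdm-spinup-window.dead.md`. The registered skeleton `Lines/zdm_spinup_window.lean`
(sha 9cae1b53…) reaches the route decl only through the inherited transfer stub `stub_unwindowing`
(windowed order-2 margin ⇒ filed un-windowed margin, pointwise on every MGHD of admissible data with
complete `𝓘⁺`). Lead 0 refuted that stub on an ABSTRACT development (`LeadVerdict.stub_unwindowing_false_of`,
five hypotheses: admissible datum, maximal development, complete `𝓘⁺`, windowed margin, junk at every
tolerance). Since then the tree has grown exactly the facts that discharge four of the five at ONE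
CONCRETE development, Minkowski space as the development of the trivial datum:

* admissible: `trivialData_mem_admissibleVacuumData` (landed);
* maximal: `Minkowski.isMaximal_vacuumCauchyDevelopment` (landed, `CompleteDevelopmentMaximal.lean`),
  conditional only on the PUBLISHED named fact `choquetBruhat_geroch_exists_mghd_cauchy`
  (Choquet-Bruhat–Geroch 1969, Thm. 3);
* complete `𝓘⁺`: `minkowski_hasCompleteNullInfinity` (landed, `Theorems/WeakCosmicCensorshipMGHD/Negative/LoadBearing.lean`);
* the WINDOWED order-2 margin: `minkowskiDevelopment_windowedMargin₂` below — unconditional (Kretschmann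
  exclusion `KerrWindow.minkowski_truncDeviationCk_gt_of_window` + the discharged closed form
  `Kerr.kretschmannScalar_closedForm_holds`; proposed to Literature as p159028).

What remains is the fifth, now fully concrete: `MinkowskiExtremalJunkCollars` — at every `(k₁, δ₁, K₁)`
Minkowski space carries a thick collar chart of extremal label `a₁ = M₁ > 0` meeting the filed clause's
hypotheses (a statement about smooth open embeddings of subsets of `ℝ⁴` into `(ℝ⁴, η)`; expected TRUE by
degree-0 homogeneity of Kerr–Schild at labels `M₁ → ∞` and the Lorentzian one-sided Nash–Kuiper theorem,
Boukholkhal arXiv:2407.19333v2 Thm 1.2 / Prop 5.1, source re-read this session; no Cauchy stability and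
no far-field analysis is involved any more). Results (all sorry-free):

* `stub_unwindowing_imp_minkowskiCollarMargin` — under CBG, the registered stub IMPLIES that Minkowski
  space has an UN-windowed collar margin (the filed clause read for `Minkowski.vacuumCauchyDevelopment`);
* `stub_unwindowing_false_of_minkowskiJunk` — hence `choquetBruhat_geroch_exists_mghd_cauchy →
  MinkowskiExtremalJunkCollars → ¬ stub_unwindowing` (the stub's registered signature, verbatim);
* `crux_false_of_cbg_of_extremalJunkCollars` — the landed crux refutation p146745 with the route item
  `MGHDExists` replaced by the Literature named fact (one line).

No reshape survives: any stub set whose composition reaches the filed clause at this development meets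
`not_collarMarginClause_of_junk` (p103863) — `LeadVerdict.filedClause_false_of_junk`. The line is dead
at `stub_unwindowing`; the crux is MISSTATED (restate per `VERDICT-lead0.md` §2).
-/

noncomputable section

-- D-0017: single-problem summit, `Summit.<S>.<S>.…` by design (cf. lakefile `weak.linter.dupNamespace`).
set_option linter.dupNamespace false

open Set
open scoped Manifold ContDiff ENNReal Topology

namespace Summit.FinalStateConjecture.FinalStateConjecture.Cruxes.TameCensorshipCollarMargin.LeadA1

open Literature.Geometry.Lorentzian
open Summit.FinalStateConjecture.FinalStateConjecture.Theorems.GenericCensorshipCollarMargin.Negative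
  (ExtremalJunkCollars not_collarMarginClause_of_junk)
open Summit.FinalStateConjecture.FinalStateConjecture.Theorems.WeakCosmicCensorshipMGHD.Negative
  (minkowski_hasCompleteNullInfinity)

/-- **Construction hypothesis `H'` — extremal junk collars in MINKOWSKI space.** At every order `k₁`,
size `0 < δ₁` and compact `K₁ ⊆ ℝ⁴`, Minkowski space (as the development
`Minkowski.vacuumCauchyDevelopment` of the trivial datum) carries a thick collar chart of EXTREMAL label
`(M₁, a₁ = M₁)`, `0 < M₁`, on the boosted Kerr star background, smooth on and an open embedding of the
collar layer, `δ₁`-close in `C^{k₁}` to boosted Kerr on the thick slab, slab image outside `J⁻(K₁)` —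
verbatim the hypothesis `hJ` of `not_collarMarginClause_of_junk` at this development (the specialisation
of `ExtremalJunkCollars` to one spacetime; expected TRUE: labels `M₁ → ∞`, `Kerr.bilin_smul_smul`, and
Boukholkhal arXiv:2407.19333v2 Thm 1.2; NOT constructed in the tree — convex integration). -/
def MinkowskiExtremalJunkCollars : Prop :=
  ∀ (k₁ : ℕ) (δ₁ : ℝ≥0∞) (K₁ : Set Minkowski.vacuumCauchyDevelopment.carrier), 0 < δ₁ → IsCompact K₁ →
    ∃ (M₁ : ℝ) (mo₁ : lorentzGroup × E4) (B₁ : ModelBackground)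
      (Φ₁ : B₁.domain → Minkowski.vacuumCauchyDevelopment.carrier),
      0 < M₁ ∧
      B₁ = starBackground mo₁.1 mo₁.2 M₁ M₁ (fun x => Kerr.radius M₁ (poincareInv mo₁.1 mo₁.2 x)) ∧
      ContMDiffOn 𝓘(ℝ, E4) (𝓡 4) ((⊤ : ℕ∞) : WithTop ℕ∞) Φ₁
        {x | -1 < B₁.time x.1 ∧ B₁.time x.1 < 1 ∧ B₁.radius x.1 < 3 * M₁ + 1} ∧
      Topology.IsOpenEmbedding
        ({x | -1 < B₁.time x.1 ∧ B₁.time x.1 < 1 ∧ B₁.radius x.1 < 3 * M₁ + 1}.restrict Φ₁) ∧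
      Minkowski.vacuumCauchyDevelopment.toSpacetime.truncDeviationCk B₁ Φ₁ k₁ (3 * M₁) 0 ≤ δ₁ ∧
      Disjoint (Φ₁ '' B₁.truncTimeSlab (3 * M₁) 0)
        (Minkowski.vacuumCauchyDevelopment.metric.causalPast Minkowski.vacuumCauchyDevelopment.timeOrientation K₁)

/-- **The windowed order-`2` collar-margin clause holds for the Minkowski development — unconditionally,
vacuously** (no windowed `C²`-quiet Kerr collar exists in flat space:
`KerrWindow.minkowski_truncDeviationCk_gt_of_window` with `Kerr.kretschmannScalar_closedForm_holds`;
`χ₁ = 0`, `K₁ = ∅`). Verbatim the hypothesis of `stub_unwindowing` at `𝒟 := Minkowski.vacuumCauchyDevelopment`.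
(= `KerrWindow.minkowskiDevelopment_windowedMargin₂` of p159028, re-proved here so that this certificate
does not wait for that proposal.) -/
theorem minkowskiDevelopment_windowedMargin₂ :
    (∀ m₀ ρ₀ : ℝ, 0 < m₀ → 0 < ρ₀ → ∃ (χ₁ : ℝ) (δ₁ : ENNReal) (K₁ : Set Minkowski.vacuumCauchyDevelopment.carrier), χ₁ < 1 ∧ 0 < δ₁ ∧ IsCompact K₁ ∧ ∀ (M₁ a₁ : ℝ) (mo₁ : lorentzGroup × E4) (B₁ : ModelBackground) (Φ₁ : B₁.domain → Minkowski.vacuumCauchyDevelopment.carrier), m₀ ≤ M₁ → M₁ ≤ m₀⁻¹ → max ‖((mo₁.1 : E4 ≃L[ℝ] E4) : E4 →L[ℝ] E4)‖ ‖((mo₁.1 : E4 ≃L[ℝ] E4).symm : E4 →L[ℝ] E4)‖ ≤ ρ₀ → |a₁| ≤ M₁ → B₁ = starBackground mo₁.1 mo₁.2 M₁ a₁ (fun x => Kerr.radius a₁ (poincareInv mo₁.1 mo₁.2 x)) → ContMDiffOn 𝓘(ℝ, E4) (𝓡 4) ((⊤ : ℕ∞) : WithTop ℕ∞) Φ₁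 {x | -1 < B₁.time x.1 ∧ B₁.time x.1 < 1 ∧ B₁.radius x.1 < 3 * M₁ + 1} → Topology.IsOpenEmbedding ({x | -1 < B₁.time x.1 ∧ B₁.time x.1 < 1 ∧ B₁.radius x.1 < 3 * M₁ + 1}.restrict Φ₁) → Minkowski.vacuumCauchyDevelopment.toSpacetime.truncDeviationCk B₁ Φ₁ 2 (3 * M₁) 0 ≤ δ₁ → Disjoint (Φ₁ '' B₁.truncTimeSlab (3 * M₁) 0) (Minkowski.vacuumCauchyDevelopment.metric.causalPast Minkowski.vacuumCauchyDevelopment.timeOrientation K₁) → |a₁| ≤ χ₁ * M₁) := by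
  intro m₀ ρ₀ hm₀ _
  obtain ⟨δ₀, hδ₀, H⟩ :=
    KerrWindow.minkowski_truncDeviationCk_gt_of_window Kerr.kretschmannScalar_closedForm_holds hm₀ ρ₀
  refine ⟨0, ENNReal.ofReal δ₀, ∅, zero_lt_one, ENNReal.ofReal_pos.2 hδ₀, isCompact_empty, ?_⟩
  intro M₁ a₁ mo₁ B₁ Φ₁ hlo hhi hmo ha hB hΦ _ hdev _
  exact absurd hdev (not_le.2 (H M₁ a₁ mo₁.1 mo₁.2 B₁ Φ₁ hlo hhi ha ((le_max_left _ _).trans hmo)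
    ((le_max_right _ _).trans hmo) hB hΦ))

/-- **Under Choquet-Bruhat–Geroch, the registered transfer stub IMPLIES that Minkowski space has an
UN-windowed collar margin** (the filed clause read for `Minkowski.vacuumCauchyDevelopment`): apply the
stub at `X := Minkowski.slice`, `D := trivialData` (admissible), `𝒟 := Minkowski.vacuumCauchyDevelopment`
(maximal under CBG, complete `𝓘⁺`), and feed it the windowed clause, which holds there vacuously. So the
stub stands or falls with a concrete statement about open embeddings `ℝ⁴ ⊇ U → (ℝ⁴, η)`. -/
theorem stub_unwindowing_imp_minkowskiCollarMargin
    (hcbg : choquetBruhat_geroch_exists_mghd_cauchy)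
    (h₅ : ∀ (X : Type) [TopologicalSpace X] [ChartedSpace E3 X] [IsManifold (𝓡 3) ((⊤ : ℕ∞) : WithTop ℕ∞) X] [T2Space X] [SecondCountableTopology X] [ConnectedSpace X], ∀ D ∈ admissibleVacuumData X, ∀ 𝒟 : VacuumCauchyDevelopment D, 𝒟.IsMaximal → Summit.FinalStateConjecture.HasCompleteNullInfinity 𝒟.toCauchyDevelopment → (∀ m₀ ρ₀ : ℝ, 0 < m₀ → 0 < ρ₀ → ∃ (χ₁ : ℝ) (δ₁ : ENNReal) (K₁ : Set 𝒟.carrier), χ₁ < 1 ∧ 0 < δ₁ ∧ IsCompact K₁ ∧ ∀ (M₁ a₁ : ℝ) (mo₁ : lorentzGroup × E4) (B₁ : ModelBackground) (Φ₁ : B₁.domain → 𝒟.carrier), m₀ ≤ M₁ → M₁ ≤ m₀⁻¹ → max ‖((mo₁.1 : E4 ≃L[ℝ] E4) : E4 →L[ℝ] E4)‖ ‖((mo₁.1 : E4 ≃L[ℝ] E4).symm : E4 →L[ℝ] E4)‖ ≤ ρ₀ → |a₁| ≤ M₁ → B₁ = starBackground mo₁.1 mo₁.2 M₁ a₁ (fun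 x => Kerr.radius a₁ (poincareInv mo₁.1 mo₁.2 x)) → ContMDiffOn 𝓘(ℝ, E4) (𝓡 4) ((⊤ : ℕ∞) : WithTop ℕ∞) Φ₁ {x | -1 < B₁.time x.1 ∧ B₁.time x.1 < 1 ∧ B₁.radius x.1 < 3 * M₁ + 1} → Topology.IsOpenEmbedding ({x | -1 < B₁.time x.1 ∧ B₁.time x.1 < 1 ∧ B₁.radius x.1 < 3 * M₁ + 1}.restrict Φ₁) → 𝒟.toSpacetime.truncDeviationCk B₁ Φ₁ 2 (3 * M₁) 0 ≤ δ₁ → Disjoint (Φ₁ '' B₁.truncTimeSlab (3 * M₁) 0) (𝒟.metric.causalPast 𝒟.timeOrientation K₁) → |a₁| ≤ χ₁ * M₁) → (∃ (χ₁ : ℝ) (k₁ : ℕ) (δ₁ : ENNReal) (K₁ : Set 𝒟.carrier), χ₁ < 1 ∧ 0 < δ₁ ∧ IsCompact K₁ ∧ ∀ (M₁ a₁ : ℝ) (mo₁ : lorentzGroup × E4) (B₁ : ModelBackground) (Φ₁ : B₁.domain → 𝒟.carrier), 0 < M₁ → |a₁| ≤ M₁ → B₁ = starBackground mo₁.1 mo₁.2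 M₁ a₁ (fun x => Kerr.radius a₁ (poincareInv mo₁.1 mo₁.2 x)) → ContMDiffOn 𝓘(ℝ, E4) (𝓡 4) ((⊤ : ℕ∞) : WithTop ℕ∞) Φ₁ {x | -1 < B₁.time x.1 ∧ B₁.time x.1 < 1 ∧ B₁.radius x.1 < 3 * M₁ + 1} → Topology.IsOpenEmbedding ({x | -1 < B₁.time x.1 ∧ B₁.time x.1 < 1 ∧ B₁.radius x.1 < 3 * M₁ + 1}.restrict Φ₁) → 𝒟.toSpacetime.truncDeviationCk B₁ Φ₁ k₁ (3 * M₁) 0 ≤ δ₁ → Disjoint (Φ₁ '' B₁.truncTimeSlab (3 * M₁) 0) (𝒟.metric.causalPast 𝒟.timeOrientation K₁) → |a₁| ≤ χ₁ * M₁)) :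
    (∃ (χ₁ : ℝ) (k₁ : ℕ) (δ₁ : ENNReal) (K₁ : Set Minkowski.vacuumCauchyDevelopment.carrier), χ₁ < 1 ∧ 0 < δ₁ ∧ IsCompact K₁ ∧ ∀ (M₁ a₁ : ℝ) (mo₁ : lorentzGroup × E4) (B₁ : ModelBackground) (Φ₁ : B₁.domain → Minkowski.vacuumCauchyDevelopment.carrier), 0 < M₁ → |a₁| ≤ M₁ → B₁ = starBackground mo₁.1 mo₁.2 M₁ a₁ (fun x => Kerr.radius a₁ (poincareInv mo₁.1 mo₁.2 x)) → ContMDiffOn 𝓘(ℝ, E4) (𝓡 4) ((⊤ : ℕ∞) : WithTop ℕ∞) Φ₁ {x | -1 < B₁.time x.1 ∧ B₁.time x.1 < 1 ∧ B₁.radius x.1 < 3 * M₁ + 1} → Topology.IsOpenEmbedding ({x | -1 < B₁.time x.1 ∧ B₁.time x.1 < 1 ∧ B₁.radius x.1 < 3 * M₁ + 1}.restrict Φ₁) → Minkowski.vacuumCauchyDevelopment.toSpacetime.truncDeviationCk B₁ Φ₁ k₁ (3 * M₁) 0 ≤ δ₁ → Disjoint (Φ₁ '' B₁.truncTimeSlab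 (3 * M₁) 0) (Minkowski.vacuumCauchyDevelopment.metric.causalPast Minkowski.vacuumCauchyDevelopment.timeOrientation K₁) → |a₁| ≤ χ₁ * M₁) :=
  h₅ Minkowski.slice trivialData trivialData_mem_admissibleVacuumData Minkowski.vacuumCauchyDevelopment
    (Minkowski.isMaximal_vacuumCauchyDevelopment hcbg) minkowski_hasCompleteNullInfinity
    minkowskiDevelopment_windowedMargin₂

/-- **`stub_unwindowing` is false modulo Choquet-Bruhat–Geroch and Minkowski junk** — the registered
signature of the stub, verbatim, negated: `choquetBruhat_geroch_exists_mghd_cauchy →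
MinkowskiExtremalJunkCollars → ¬ stub_unwindowing`. Four of the five hypotheses of lead 0's
`LeadVerdict.stub_unwindowing_false_of` are discharged at the Minkowski development; the fifth is `H'`.
This is where line `zdm-spinup-window` (and `birth`, and any skeleton of the filed text) dies. -/
theorem stub_unwindowing_false_of_minkowskiJunk
    (hcbg : choquetBruhat_geroch_exists_mghd_cauchy) (hJ : MinkowskiExtremalJunkCollars) :
    ¬ (∀ (X : Type) [TopologicalSpace X] [ChartedSpace E3 X] [IsManifold (𝓡 3) ((⊤ : ℕ∞) : WithTop ℕ∞) X] [T2Space X] [SecondCountableTopology X] [ConnectedSpace X], ∀ D ∈ admissibleVacuumData X, ∀ 𝒟 : VacuumCauchyDevelopment D, 𝒟.IsMaximal → Summit.FinalStateConjecture.HasCompleteNullInfinity 𝒟.toCauchyDevelopment → (∀ m₀ ρ₀ : ℝ, 0 < m₀ → 0 < ρ₀ → ∃ (χ₁ : ℝ) (δ₁ : ENNReal) (K₁ : Set 𝒟.carrier), χ₁ < 1 ∧ 0 < δ₁ ∧ IsCompact K₁ ∧ ∀ (M₁ a₁ : ℝ) (mo₁ : lorentzGroup × E4) (B₁ : ModelBackground)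 (Φ₁ : B₁.domain → 𝒟.carrier), m₀ ≤ M₁ → M₁ ≤ m₀⁻¹ → max ‖((mo₁.1 : E4 ≃L[ℝ] E4) : E4 →L[ℝ] E4)‖ ‖((mo₁.1 : E4 ≃L[ℝ] E4).symm : E4 →L[ℝ] E4)‖ ≤ ρ₀ → |a₁| ≤ M₁ → B₁ = starBackground mo₁.1 mo₁.2 M₁ a₁ (fun x => Kerr.radius a₁ (poincareInv mo₁.1 mo₁.2 x)) → ContMDiffOn 𝓘(ℝ, E4) (𝓡 4) ((⊤ : ℕ∞) : WithTop ℕ∞) Φ₁ {x | -1 < B₁.time x.1 ∧ B₁.time x.1 < 1 ∧ B₁.radius x.1 < 3 * M₁ + 1} → Topology.IsOpenEmbedding ({x | -1 < B₁.time x.1 ∧ B₁.time x.1 < 1 ∧ B₁.radius x.1 < 3 * M₁ + 1}.restrict Φ₁) → 𝒟.toSpacetime.truncDeviationCk B₁ Φ₁ 2 (3 * M₁) 0 ≤ δ₁ → Disjoint (Φ₁ '' B₁.truncTimeSlab (3 * M₁) 0) (𝒟.metric.causalPast 𝒟.timeOrientation K₁) → |a₁| ≤ χ₁ * M₁) → (∃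 (χ₁ : ℝ) (k₁ : ℕ) (δ₁ : ENNReal) (K₁ : Set 𝒟.carrier), χ₁ < 1 ∧ 0 < δ₁ ∧ IsCompact K₁ ∧ ∀ (M₁ a₁ : ℝ) (mo₁ : lorentzGroup × E4) (B₁ : ModelBackground) (Φ₁ : B₁.domain → 𝒟.carrier), 0 < M₁ → |a₁| ≤ M₁ → B₁ = starBackground mo₁.1 mo₁.2 M₁ a₁ (fun x => Kerr.radius a₁ (poincareInv mo₁.1 mo₁.2 x)) → ContMDiffOn 𝓘(ℝ, E4) (𝓡 4) ((⊤ : ℕ∞) : WithTop ℕ∞) Φ₁ {x | -1 < B₁.time x.1 ∧ B₁.time x.1 < 1 ∧ B₁.radius x.1 < 3 * M₁ + 1} → Topology.IsOpenEmbedding ({x | -1 < B₁.time x.1 ∧ B₁.time x.1 < 1 ∧ B₁.radius x.1 < 3 * M₁ + 1}.restrict Φ₁) → 𝒟.toSpacetime.truncDeviationCk B₁ Φ₁ k₁ (3 * M₁) 0 ≤ δ₁ → Disjoint (Φ₁ '' B₁.truncTimeSlab (3 * M₁) 0) (𝒟.metric.causalPast 𝒟.timeOrientation K₁) → |a₁|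 ≤ χ₁ * M₁)) := fun h₅ =>
  not_collarMarginClause_of_junk Minkowski.vacuumCauchyDevelopment hJ
    (stub_unwindowing_imp_minkowskiCollarMargin hcbg h₅)

/-- **The crux refutation with the route item `MGHDExists` replaced by the Literature named fact**:
`choquetBruhat_geroch_exists_mghd_cauchy → ExtremalJunkCollars → ¬ TameCensorshipCollarMargin`
(p146745 composed with `choquetBruhat_geroch_exists_mghd_cauchy.forall_mem_admissibleVacuumData`). -/
theorem crux_false_of_cbg_of_extremalJunkCollars
    (hcbg : choquetBruhat_geroch_exists_mghd_cauchy) (hJ : ExtremalJunkCollars) :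
    ¬ Summit.FinalStateConjecture.FinalStateConjecture.Theses.BartnikGapSettling.TameCensorshipCollarMargin :=
  Summit.FinalStateConjecture.FinalStateConjecture.Theorems.TameCensorshipCollarMargin.Negative.TameCensorshipCollarMargin_false_of_ExtremalJunkCollars
    hJ hcbg.forall_mem_admissibleVacuumData

end Summit.FinalStateConjecture.FinalStateConjecture.Cruxes.TameCensorshipCollarMargin.LeadA1

end
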